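import Mathlib.Analysis.Complex.ExponentialBounds
import Mathlib.Analysis.SpecialFunctions.Pow.Real
import HarnessLib

/-!
# Route `UnitScaleTilt`, crux K1 «MinimiserStabilityRegPr» (stmt-QuantumFields-19200), EX row `hGF[Lift]` (curved member) — **LOD LINE, (L6) SLOT `hK₂`, PIECE (K2b): THE REAL-ARITHMETIC
# LETTERS OF THE WINDOW BOOKKEEPING** — the η-LEMMA `η⁻¹(e^{xη} − 1) ≤ 3x` (`0 < η ≤ 1`, `0 ≤ x ≤ 1`; K-uniformity of routeR-w2's Combes–Thomas letters, `η = L^{−(K−n)}`), the window at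
# slope `μ` (`hδ`, `hwin`), the gap at slope `μ′` (`hgap`) of ✓`kernelMatrix_blockBound_of_regPr` (p754496) in ATOM form (`M`, `sx`, `dEx`, `η` for the member's raw letters), and the
# K-free bound `big_le` of ✓`Prop7LODSlotK2MemberOfRegPr.hKP_of_regPr'`'s bracket (routeR-w4 g27, p759208).  Consumed by ✓∕⧗`…Prop7LODSlotK2MemberWindow.hKP_pin` (the member reading).

Cell `ym3-torus` (HUMAN RULING D-0037, YM ladder rung R3 — NOT d = 4, NOT infinite volume, NOT a mass gap, NOT Clay).  Width seat `ym-routeR-w4` gen 27 («MINE §2b» 2026-08-30 03:39:52Z).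
THEOREMS ONLY (0 `def`, 0 `sorry`); `--supports stmt-QuantumFields-19200 --as helper`, count-neutral.  HONEST LABEL (★★OWNER RULING №33 (6)): curved γ-row supplier line; PURE REAL
ARITHMETIC (Mathlib `Real.add_one_le_exp`, `Real.exp_one_lt_d9`, `gcongr`); nothing of (K2b)'s member rows, `hloc`, the window `γ > 0`, `hT`, `hGF`, EX ∕ 19200 is proved here.

WHAT IS PROVED (ns `Summit.QuantumFields.YangMills.Theorems.Prop7LODSlotK2WindowLetters`): `exp_three_mul_sub_one_le_nine_mul` (`e^{3μ} − 1 ≤ 9μ`, `3μ ≤ 1`), `inv_mul_exp_sub_one_le` (the η-lemma),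
`inv_mul_exp_sub_one_nonneg`; `window_delta` (`hδ` at `δ₁ := √(27 + (2025∕8)a)·μ`, any `3μ ≤ 1`, `sx = 25∕8`); `window_win` (`hwin` with EQUALITY at
`μ := 1∕(10·√(max 2 (16∕a))·√(27 + (2025∕8)a))`); `gap_nonneg`; `gap_le` (B6's gap term `≤ Γ(a)·μ′` for `3μ′ ≤ 1`, `Γ(a)` closed); `window_gap` (`3·GAP² < m_B²∕2`, `0 < m_B²∕2 − 3GAP²`,
`(m_B²∕2 − 3GAP²)⁻¹ ≤ 6∕m_B²` once `GAP ≤ Γμ′`, `μ′ ≤ m_B∕(3Γ)`); `big_le` (the bracket of ✓p759208 `≤ CP(a, μ, ν̄)∕Ls²` given `10μ ≤ 1`, `μ′ ≤ μ∕2`, `1∕μ′ ≤ ν̄`, the gap letters, `ℓ ≥ 1`).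

References: T. Bałaban, CMP **99** (1985) 389–434 [Balaban1985BackgroundPropagators] (Thm 3.1 (3.46) p.398, (3.49) p.399, Thm 3.11 p.416); CMP **119** (1988) 243–285
[Balaban1988RG2Cluster] ((2.7) p.13).
-/

set_option autoImplicit false

noncomputable section

namespace Summit.QuantumFields.YangMills.Theorems.Prop7LODSlotK2WindowLetters


/-- `e^{3μ} − 1 ≤ 9μ` for `0 ≤ μ`, `3μ ≤ 1` (`e^y − 1 ≤ y·e^y ≤ 3y` on `[0,1]`, from `1 − y ≤ e^{−y}` and `e ≤ 3`). [cite: Balaban1985BackgroundPropagators, (3.49) p.399] -/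
theorem exp_three_mul_sub_one_le_nine_mul {μ : ℝ} (h0 : 0 ≤ μ) (h1 : 3 * μ ≤ 1) : Real.exp (3 * μ) - 1 ≤ 9 * μ := by
  have h := Real.add_one_le_exp (-(3 * μ))
  have hpos := Real.exp_pos (3 * μ)
  have h2 : (1 - 3 * μ) * Real.exp (3 * μ) ≤ 1 := by
    have := mul_le_mul_of_nonneg_right h hpos.le
    rw [← Real.exp_add, neg_add_cancel, Real.exp_zero] at this
    linarith
  have he : Real.exp (3 * μ) ≤ 3 := by
    have h3 := Real.exp_one_lt_d9
    have h4 : Real.exp (3 * μ) ≤ Real.exp 1 := Real.exp_le_exp.2 h1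
    linarith
  nlinarith

/-- Real-arithmetic letter `inv_mul_exp_sub_one_le` of the (K2b) window bookkeeping (see the module docstring). [cite: Balaban1985BackgroundPropagators, (3.49) p.399] -/
theorem inv_mul_exp_sub_one_le {η x : ℝ} (hη : 0 < η) (hη1 : η ≤ 1) (hx0 : 0 ≤ x) (hx1 : x ≤ 1) :
    η⁻¹ * (Real.exp (x * η) - 1) ≤ 3 * x := by
  have hy0 : 0 ≤ x * η := mul_nonneg hx0 hη.le
  have hy1 : x * η ≤ 1 := by nlinarith
  -- `e^y − 1 ≤ 3y` at `y = xη ∈ [0,1]`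
  have h : Real.exp (x * η) - 1 ≤ 3 * (x * η) := by
    have h' := Real.add_one_le_exp (-(x * η))
    have hpos := Real.exp_pos (x * η)
    have h2 : (1 - x * η) * Real.exp (x * η) ≤ 1 := by
      have := mul_le_mul_of_nonneg_right h' hpos.le
      rw [← Real.exp_add, neg_add_cancel, Real.exp_zero] at this
      linarith
    have he : Real.exp (x * η) ≤ 3 := by
      have h3 := Real.exp_one_lt_d9
      have h4 : Real.exp (x * η) ≤ Real.exp 1 := Real.exp_le_exp.2 hy1
      linarith
    nlinarith
  rw [inv_mul_le_iff₀ hη]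
  linarith

/-- Real-arithmetic letter `inv_mul_exp_sub_one_nonneg` of the (K2b) window bookkeeping (see the module docstring). [cite: Balaban1985BackgroundPropagators, (3.49) p.399] -/
theorem inv_mul_exp_sub_one_nonneg {η x : ℝ} (hη : 0 < η) (hx0 : 0 ≤ x) : 0 ≤ η⁻¹ * (Real.exp (x * η) - 1) := by
  have : 0 ≤ Real.exp (x * η) - 1 := by
    have := Real.add_one_le_exp (x * η)
    nlinarith [mul_nonneg hx0 hη.le]
  positivity

/-- (L-a) the window at slope `μ`. [cite: Balaban1985BackgroundPropagators, (3.46) p.398, (3.49) p.399] -/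
theorem window_delta {a sx η : ℝ} (ha : 0 < a) (hsx : sx = 25 / 8) (hη : 0 < η) (hη1 : η ≤ 1)
    {μ : ℝ} (hμ0 : 0 ≤ μ) (hμ1 : 3 * μ ≤ 1) :
    3 * ((η)⁻¹) ^ 2 * (Real.exp (μ * η) - 1) ^ 2 + a * (sx) * (Real.exp (3 * μ) - 1) ^ 2 ≤ (Real.sqrt (27 + 2025 / 8 * a) * μ) ^ 2 := by
  subst hsx
  have t1 := inv_mul_exp_sub_one_le hη hη1 hμ0 (by linarith)
  have t1' := inv_mul_exp_sub_one_nonneg hη hμ0 (x := μ)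
  have t2 := exp_three_mul_sub_one_le_nine_mul hμ0 hμ1
  have t2' : 0 ≤ Real.exp (3 * μ) - 1 := by have := Real.add_one_le_exp (3 * μ); linarith
  have e2 : (Real.sqrt (27 + 2025 / 8 * a) * μ) ^ 2 = (27 + 2025 / 8 * a) * μ ^ 2 := by
    rw [mul_pow, Real.sq_sqrt (by positivity)]
  rw [e2]
  have h1 : (η⁻¹ * (Real.exp (μ * η) - 1)) ^ 2 ≤ (3 * μ) ^ 2 := pow_le_pow_left₀ t1' t1 2
  have h2 : (Real.exp (3 * μ) - 1) ^ 2 ≤ (9 * μ) ^ 2 := pow_le_pow_left₀ t2' t2 2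
  rw [mul_pow] at h1
  nlinarith [h1, h2, ha.le]

/-- (L-b) `√M·δ₁ = 1/10`. [cite: Balaban1985BackgroundPropagators, (3.46) p.398, (3.49) p.399] -/
theorem window_win {a : ℝ} (ha : 0 < a) {M : ℝ} (hM : M = max 2 (16 / a)) :
    Real.sqrt M * (Real.sqrt (27 + 2025 / 8 * a) * (1 / (10 * Real.sqrt (max 2 (16 / a)) * Real.sqrt (27 + 2025 / 8 * a)))) ≤ 1 / 10 := by
  subst hM
  have h1 : 0 < Real.sqrt (max 2 (16 / a)) := Real.sqrt_pos.2 (lt_of_lt_of_le two_pos (le_max_left _ _))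
  have h2 : 0 < Real.sqrt (27 + 2025 / 8 * a) := Real.sqrt_pos.2 (by positivity)
  apply le_of_eq
  field_simp

/-- The gap term of ✓`kernelMatrix_blockBound_of_regPr` is non-negative. [cite: Balaban1985BackgroundPropagators, (3.49) p.399] -/
theorem gap_nonneg {a sx η M μ' : ℝ} (ha : 0 < a) (hη : 0 < η) (hM : 0 ≤ M) (hμ'0 : 0 ≤ μ') :
    0 ≤ (Real.sqrt M * (2 + Real.sqrt M)
          * (Real.sqrt 3 * (η)⁻¹ * (Real.exp (μ' * η) - 1) + (Real.sqrt 3 * (η)⁻¹ * (Real.exp (μ' * η) - 1)) ^ 2 + Real.sqrt a * (Real.sqrt (sx)) * (Real.exp (3 * μ') - 1) + a * (Real.sqrt (sx)) ^ 2 * (Real.exp (3 * μ') - 1) ^ 2)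
          * (8 * Real.sqrt M + 8 * Real.sqrt M ^ 2)
          * ((Real.sqrt (sx)) * (1 + (Real.exp (3 * μ') - 1))) + M * ((Real.sqrt (sx)) * (Real.exp (3 * μ') - 1))) := by
  have t0 := inv_mul_exp_sub_one_nonneg hη hμ'0 (x := μ')
  have X0 : 0 ≤ Real.exp (3 * μ') - 1 := by have := Real.add_one_le_exp (3 * μ'); linarith
  have e1 : Real.sqrt 3 * η⁻¹ * (Real.exp (μ' * η) - 1) = Real.sqrt 3 * (η⁻¹ * (Real.exp (μ' * η) - 1)) := by ring
  rw [e1]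
  positivity

-- decl-local heartbeat insurance (cell rule «decl-local ≤ 400000, never file-global»): measured < 200000 (passes at the default), > 100000.
set_option maxHeartbeats 400000 in
/-- (L-c) THE GAP TERM IS `O(μ′)` K-UNIFORMLY: `GAP(μ′) ≤ Γ(a)·μ′` for `0 < η ≤ 1`, `0 ≤ μ′`, `3μ′ ≤ 1`. [cite: Balaban1985BackgroundPropagators, (3.46) p.398, (3.49) p.399] -/
theorem gap_le {a sx η M μ' : ℝ} (ha : 0 < a) (hsx : sx = 25 / 8) (hη : 0 < η) (hη1 : η ≤ 1) (hM : M = max 2 (16 / a))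
    (hμ'0 : 0 ≤ μ') (hμ'1 : 3 * μ' ≤ 1) :
    (Real.sqrt M * (2 + Real.sqrt M)
          * (Real.sqrt 3 * (η)⁻¹ * (Real.exp (μ' * η) - 1) + (Real.sqrt 3 * (η)⁻¹ * (Real.exp (μ' * η) - 1)) ^ 2 + Real.sqrt a * (Real.sqrt (sx)) * (Real.exp (3 * μ') - 1) + a * (Real.sqrt (sx)) ^ 2 * (Real.exp (3 * μ') - 1) ^ 2)
          * (8 * Real.sqrt M + 8 * Real.sqrt M ^ 2)
          * ((Real.sqrt (sx)) * (1 + (Real.exp (3 * μ') - 1))) + M * ((Real.sqrt (sx)) * (Real.exp (3 * μ') - 1)))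
      ≤ (Real.sqrt (max 2 (16 / a)) * (2 + Real.sqrt (max 2 (16 / a))) * (3 * Real.sqrt 3 + 27 + 9 * Real.sqrt a * Real.sqrt (25 / 8) + 81 * a * (25 / 8))
          * (8 * Real.sqrt (max 2 (16 / a)) + 8 * Real.sqrt (max 2 (16 / a)) ^ 2) * (10 * Real.sqrt (25 / 8)) + 9 * (max 2 (16 / a)) * Real.sqrt (25 / 8)) * μ' := by
  subst hsx hM
  have hμ'le : μ' ≤ 1 := by linarith
  have t0 := inv_mul_exp_sub_one_nonneg hη hμ'0 (x := μ')
  have t1 := inv_mul_exp_sub_one_le hη hη1 hμ'0 hμ'le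
  have X0 : 0 ≤ Real.exp (3 * μ') - 1 := by have := Real.add_one_le_exp (3 * μ'); linarith
  have X1 := exp_three_mul_sub_one_le_nine_mul hμ'0 hμ'1
  set t : ℝ := η⁻¹ * (Real.exp (μ' * η) - 1) with ht
  set X : ℝ := Real.exp (3 * μ') - 1 with hX
  set M : ℝ := max 2 (16 / a) with hMdef
  have hM2 : 2 ≤ M := le_max_left _ _
  have hM0 : 0 ≤ M := by linarith
  have hs3 : 0 ≤ Real.sqrt 3 := Real.sqrt_nonneg _
  have hs3' : Real.sqrt 3 ^ 2 = 3 := Real.sq_sqrt (by norm_num)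
  have hss : 0 ≤ Real.sqrt (25 / 8 : ℝ) := Real.sqrt_nonneg _
  have hss' : Real.sqrt (25 / 8 : ℝ) ^ 2 = 25 / 8 := Real.sq_sqrt (by norm_num)
  have hsa : 0 ≤ Real.sqrt a := Real.sqrt_nonneg _
  have hsM : 0 ≤ Real.sqrt M := Real.sqrt_nonneg _
  have hE : Real.sqrt 3 * η⁻¹ * (Real.exp (μ' * η) - 1) + (Real.sqrt 3 * η⁻¹ * (Real.exp (μ' * η) - 1)) ^ 2
        + Real.sqrt a * Real.sqrt (25 / 8) * X + a * Real.sqrt (25 / 8) ^ 2 * X ^ 2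
      ≤ (3 * Real.sqrt 3 + 27 + 9 * Real.sqrt a * Real.sqrt (25 / 8) + 81 * a * (25 / 8)) * μ' := by
    have e1 : Real.sqrt 3 * η⁻¹ * (Real.exp (μ' * η) - 1) = Real.sqrt 3 * t := by rw [ht]; ring
    rw [e1, hss']
    have h1 : Real.sqrt 3 * t ≤ Real.sqrt 3 * (3 * μ') := mul_le_mul_of_nonneg_left t1 hs3
    have h2 : (Real.sqrt 3 * t) ^ 2 ≤ 27 * μ' := by
      have : (Real.sqrt 3 * t) ^ 2 ≤ (Real.sqrt 3 * (3 * μ')) ^ 2 := pow_le_pow_left₀ (by positivity) h1 2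
      have e2 : (Real.sqrt 3 * (3 * μ')) ^ 2 = 27 * μ' ^ 2 := by rw [mul_pow, hs3']; ring
      nlinarith
    have h3 : Real.sqrt a * Real.sqrt (25 / 8) * X ≤ Real.sqrt a * Real.sqrt (25 / 8) * (9 * μ') := by
      exact mul_le_mul_of_nonneg_left (by linarith) (by positivity)
    have h4 : a * (25 / 8) * X ^ 2 ≤ a * (25 / 8) * (81 * μ') := by
      refine mul_le_mul_of_nonneg_left ?_ (by positivity)
      have : X ^ 2 ≤ (9 * μ') ^ 2 := pow_le_pow_left₀ X0 (by linarith) 2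
      nlinarith
    nlinarith [h1, h2, h3, h4]
  have hf4a : Real.sqrt (25 / 8) * (1 + X) ≤ 10 * Real.sqrt (25 / 8) := by
    have hX9 : X ≤ 9 := by linarith
    calc Real.sqrt (25 / 8) * (1 + X) ≤ Real.sqrt (25 / 8) * 10 := mul_le_mul_of_nonneg_left (by linarith) hss
      _ = 10 * Real.sqrt (25 / 8) := by ring
  have hf1 : 0 ≤ Real.sqrt M * (2 + Real.sqrt M) := by positivity
  have hf3 : 0 ≤ 8 * Real.sqrt M + 8 * Real.sqrt M ^ 2 := by positivity
  have hX9μ : X ≤ 9 * μ' := by linarith [X1]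
  calc Real.sqrt M * (2 + Real.sqrt M)
          * (Real.sqrt 3 * η⁻¹ * (Real.exp (μ' * η) - 1) + (Real.sqrt 3 * η⁻¹ * (Real.exp (μ' * η) - 1)) ^ 2 + Real.sqrt a * Real.sqrt (25 / 8) * X + a * Real.sqrt (25 / 8) ^ 2 * X ^ 2)
          * (8 * Real.sqrt M + 8 * Real.sqrt M ^ 2)
          * (Real.sqrt (25 / 8) * (1 + X)) + M * (Real.sqrt (25 / 8) * X)
      ≤ Real.sqrt M * (2 + Real.sqrt M)
          * ((3 * Real.sqrt 3 + 27 + 9 * Real.sqrt a * Real.sqrt (25 / 8) + 81 * a * (25 / 8)) * μ')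
          * (8 * Real.sqrt M + 8 * Real.sqrt M ^ 2)
          * (10 * Real.sqrt (25 / 8)) + M * (Real.sqrt (25 / 8) * (9 * μ')) := by
        gcongr
    _ = _ := by ring

/-- (L-c′) hence the GAP of the B-series holds once `μ′ ≤ m_B∕(3Γ)`, and the inverse letter of the B6 constant is `≤ 6∕m_B²`. [cite: Balaban1985BackgroundPropagators, (3.46) p.398, (3.49) p.399] -/
theorem window_gap {μ' Γ GAP mB : ℝ} (hGAP0 : 0 ≤ GAP) (hGAPle : GAP ≤ Γ * μ') (hΓ : 0 < Γ) (hmB : 0 < mB)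
    (hμ'Γ : μ' ≤ mB / (3 * Γ)) :
    3 * GAP ^ 2 < mB ^ 2 / 2 ∧ 0 < mB ^ 2 / 2 - 3 * GAP ^ 2 ∧ (mB ^ 2 / 2 - 3 * GAP ^ 2)⁻¹ ≤ 6 / mB ^ 2 := by
  have h1 : GAP ≤ mB / 3 := by
    calc GAP ≤ Γ * μ' := hGAPle
      _ ≤ Γ * (mB / (3 * Γ)) := mul_le_mul_of_nonneg_left hμ'Γ hΓ.le
      _ = mB / 3 := by field_simp
  have h2 : GAP ^ 2 ≤ (mB / 3) ^ 2 := pow_le_pow_left₀ hGAP0 h1 2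
  have h3 : 3 * GAP ^ 2 ≤ mB ^ 2 / 3 := by nlinarith
  have hm2 : 0 < mB ^ 2 := by positivity
  have hpos : 0 < mB ^ 2 / 2 - 3 * GAP ^ 2 := by nlinarith
  refine ⟨by nlinarith, hpos, ?_⟩
  rw [inv_le_comm₀ hpos (by positivity)]
  rw [show (6 / mB ^ 2)⁻¹ = mB ^ 2 / 6 by rw [inv_div]]
  nlinarith



-- decl-local heartbeat insurance (cell rule «decl-local ≤ 400000, never file-global»): measured < 200000 (passes at the default), > 100000.
set_option maxHeartbeats 400000 in
/-- (L-d)+(L-e): the (K2b) constant is bounded K-uniformly. [cite: Balaban1985BackgroundPropagators, (3.46) p.398, (3.49) p.399] -/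
theorem big_le {a sx dEx η M μ μ' ℓ Ls dd ν : ℝ} (ha : 0 < a) (hsx : sx = 25 / 8) (hdEx : dEx = 600 * (27 / 4 : ℝ) ^ 6) (hM : M = max 2 (16 / a))
    (hμ0 : 0 < μ) (hμ1 : 10 * μ ≤ 1) (hμ'0 : 0 < μ') (hμ'μ : μ' ≤ μ / 2) (hν : 1 / μ' ≤ ν)
    (hP2 : ((2 / ((1 + sx) * (dEx + a))) ^ 2 / 2 - 3 * (Real.sqrt M * (2 + Real.sqrt M)
          * (Real.sqrt 3 * (η)⁻¹ * (Real.exp (μ' * η) - 1) + (Real.sqrt 3 * (η)⁻¹ * (Real.exp (μ' * η) - 1)) ^ 2 + Real.sqrt a * (Real.sqrt (sx)) * (Real.exp (3 * μ') - 1) + a * (Real.sqrt (sx)) ^ 2 * (Real.exp (3 * μ') - 1) ^ 2)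
          * (8 * Real.sqrt M + 8 * Real.sqrt M ^ 2)
          * ((Real.sqrt (sx)) * (1 + (Real.exp (3 * μ') - 1))) + M * ((Real.sqrt (sx)) * (Real.exp (3 * μ') - 1))) ^ 2)⁻¹ ≤ 6 / (2 / ((1 + sx) * (dEx + a))) ^ 2)
    (hP2pos : 0 < (2 / ((1 + sx) * (dEx + a))) ^ 2 / 2 - 3 * (Real.sqrt M * (2 + Real.sqrt M)
          * (Real.sqrt 3 * (η)⁻¹ * (Real.exp (μ' * η) - 1) + (Real.sqrt 3 * (η)⁻¹ * (Real.exp (μ' * η) - 1)) ^ 2 + Real.sqrt a * (Real.sqrt (sx)) * (Real.exp (3 * μ') - 1) + a * (Real.sqrt (sx)) ^ 2 * (Real.exp (3 * μ') - 1) ^ 2)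
          * (8 * Real.sqrt M + 8 * Real.sqrt M ^ 2)
          * ((Real.sqrt (sx)) * (1 + (Real.exp (3 * μ') - 1))) + M * ((Real.sqrt (sx)) * (Real.exp (3 * μ') - 1))) ^ 2)
    (hℓ : 1 ≤ ℓ) (hLs : 0 < Ls) (hdd : dd = 3) :
    (2 * (ℓ ^ 2 * (2880 / (Ls * ℓ) ^ 2)) * ((8 * M * Real.sqrt (sx) * Real.exp (3 * μ)) ^ 2
          * (((2 / ((1 + sx) * (dEx + a))) ^ 2 / 2 - 3 * ((Real.sqrt M * (2 + Real.sqrt M)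
          * (Real.sqrt 3 * (η)⁻¹ * (Real.exp (μ' * η) - 1) + (Real.sqrt 3 * (η)⁻¹ * (Real.exp (μ' * η) - 1)) ^ 2 + Real.sqrt a * (Real.sqrt (sx)) * (Real.exp (3 * μ') - 1) + a * (Real.sqrt (sx)) ^ 2 * (Real.exp (3 * μ') - 1) ^ 2)
          * (8 * Real.sqrt M + 8 * Real.sqrt M ^ 2)
          * ((Real.sqrt (sx)) * (1 + (Real.exp (3 * μ') - 1))) + M * ((Real.sqrt (sx)) * (Real.exp (3 * μ') - 1)))) ^ 2)⁻¹ * Real.exp (9 * μ'))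
          * (4 * (2 * (1 + 1 / (μ - μ'))) ^ 3) ^ 2
          * ((2 / μ') * (2 * (1 + 1 / (μ' / 2))) ^ 3)) ^ 2
            + 8 * ((dd * (ℓ - 1)) ^ 2 * (2880 / (Ls * ℓ) ^ 2)) * ((8 * M * Real.sqrt (sx) * Real.exp (3 * μ)) ^ 2
          * (((2 / ((1 + sx) * (dEx + a))) ^ 2 / 2 - 3 * ((Real.sqrt M * (2 + Real.sqrt M)
          * (Real.sqrt 3 * (η)⁻¹ * (Real.exp (μ' * η) - 1) + (Real.sqrt 3 * (η)⁻¹ * (Real.exp (μ' * η) - 1)) ^ 2 + Real.sqrt a * (Real.sqrt (sx)) * (Real.exp (3 * μ') - 1) + a * (Real.sqrt (sx)) ^ 2 * (Real.exp (3 * μ') - 1) ^ 2)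
          * (8 * Real.sqrt M + 8 * Real.sqrt M ^ 2)
          * ((Real.sqrt (sx)) * (1 + (Real.exp (3 * μ') - 1))) + M * ((Real.sqrt (sx)) * (Real.exp (3 * μ') - 1)))) ^ 2)⁻¹ * Real.exp (9 * μ'))
          * (4 * (2 * (1 + 1 / (μ - μ'))) ^ 3) ^ 2
          * (2 * (1 + 1 / μ')) ^ 3) ^ 2)
      ≤ (2 * 2880 * (((24 * (max 2 (16 / a)) * Real.sqrt (25 / 8)) ^ 2 * (18 / (2 / ((1 + 25 / 8) * (600 * (27 / 4 : ℝ) ^ 6 + a))) ^ 2) * (4 * (2 * (1 + 2 / μ)) ^ 3) ^ 2) * (2 * ν * (2 * (1 + 2 * ν)) ^ 3)) ^ 2 + 72 * 2880 * (((24 * (max 2 (16 / a)) * Real.sqrt (25 / 8)) ^ 2 * (18 / (2 / ((1 + 25 / 8) * (600 * (27 / 4 : ℝ) ^ 6 + a))) ^ 2) * (4 * (2 * (1 + 2 / μ)) ^ 3) ^ 2) * (2 * (1 + ν)) ^ 3) ^ 2) / Ls ^ 2 := by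
  subst hdd
  -- small numeric facts first (cheap context)
  have hMge : (2 : ℝ) ≤ M := by rw [hM]; exact le_max_left _ _
  have hsx0 : 0 < sx := by rw [hsx]; norm_num
  have hdEx0 : 0 < dEx := by rw [hdEx]; positivity
  have hμ'1 : μ' ≤ 1 := by linarith
  have h3 : 3 * μ ≤ 1 := by linarith
  have h9 : 9 * μ' ≤ 1 := by linarith
  have hsM : 0 ≤ Real.sqrt sx := Real.sqrt_nonneg _
  have hM0 : 0 ≤ M := by linarith
  have he3 : Real.exp (3 * μ) ≤ 3 := by
    have := Real.exp_one_lt_d9; have h4 : Real.exp (3 * μ) ≤ Real.exp 1 := Real.exp_le_exp.2 h3; linarith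
  have he9 : Real.exp (9 * μ') ≤ 3 := by
    have := Real.exp_one_lt_d9; have h4 : Real.exp (9 * μ') ≤ Real.exp 1 := Real.exp_le_exp.2 h9; linarith
  have hP1 : (8 * M * Real.sqrt sx * Real.exp (3 * μ)) ^ 2 ≤ (24 * (max 2 (16 / a)) * Real.sqrt (25 / 8)) ^ 2 := by
    rw [hM, hsx]
    apply pow_le_pow_left₀ (by positivity)
    calc 8 * max 2 (16 / a) * Real.sqrt (25 / 8) * Real.exp (3 * μ) ≤ 8 * max 2 (16 / a) * Real.sqrt (25 / 8) * 3 :=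
          mul_le_mul_of_nonneg_left he3 (by positivity)
      _ = 24 * max 2 (16 / a) * Real.sqrt (25 / 8) := by ring
  have hP3 : (4 * (2 * (1 + 1 / (μ - μ'))) ^ 3) ^ 2 ≤ (4 * (2 * (1 + 2 / μ)) ^ 3) ^ 2 := by
    have hd : 1 / (μ - μ') ≤ 2 / μ := by
      rw [div_le_div_iff₀ (by linarith) hμ0]; linarith
    have hd0 : 0 ≤ 1 / (μ - μ') := div_nonneg zero_le_one (by linarith)
    gcongr
  have hν0 : 0 < ν := lt_of_lt_of_le (by positivity) hν
  have h2ν : 2 / μ' ≤ 2 * ν := by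
    have e : 2 / μ' = 2 * (1 / μ') := by ring
    rw [e]; linarith
  have hinv2 : 1 / (μ' / 2) ≤ 2 * ν := by rw [one_div_div]; exact h2ν
  have hℓ0 : 0 < ℓ := by linarith
  have hf1 : 2 * (ℓ ^ 2 * (2880 / (Ls * ℓ) ^ 2)) = 2 * 2880 / Ls ^ 2 := by field_simp
  have hf2 : 8 * (((3:ℝ) * (ℓ - 1)) ^ 2 * (2880 / (Ls * ℓ) ^ 2)) ≤ 72 * 2880 / Ls ^ 2 := by
    rw [show 8 * (((3:ℝ) * (ℓ - 1)) ^ 2 * (2880 / (Ls * ℓ) ^ 2)) = 72 * 2880 / Ls ^ 2 * ((ℓ - 1) ^ 2 / ℓ ^ 2) by field_simp; ring]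
    have hr : (ℓ - 1) ^ 2 / ℓ ^ 2 ≤ 1 := by
      rw [div_le_one (by positivity)]
      exact pow_le_pow_left₀ (by linarith) (by linarith) 2
    have h0 : 0 ≤ 72 * 2880 / Ls ^ 2 := by positivity
    exact mul_le_of_le_one_right h0 hr
  -- letters
  set G : ℝ := (Real.sqrt M * (2 + Real.sqrt M)
          * (Real.sqrt 3 * (η)⁻¹ * (Real.exp (μ' * η) - 1) + (Real.sqrt 3 * (η)⁻¹ * (Real.exp (μ' * η) - 1)) ^ 2 + Real.sqrt a * (Real.sqrt (sx)) * (Real.exp (3 * μ') - 1) + a * (Real.sqrt (sx)) ^ 2 * (Real.exp (3 * μ') - 1) ^ 2)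
          * (8 * Real.sqrt M + 8 * Real.sqrt M ^ 2)
          * ((Real.sqrt (sx)) * (1 + (Real.exp (3 * μ') - 1))) + M * ((Real.sqrt (sx)) * (Real.exp (3 * μ') - 1))) with hGdef
  set mB : ℝ := (2 / ((1 + sx) * (dEx + a))) with hmBdef
  have hmBc : mB = (2 / ((1 + 25 / 8) * (600 * (27 / 4 : ℝ) ^ 6 + a))) := by rw [hmBdef, hsx, hdEx]
  have hmB : 0 < mB := by rw [hmBc]; positivity
  have hP2' : (mB ^ 2 / 2 - 3 * G ^ 2)⁻¹ * Real.exp (9 * μ') ≤ 18 / (2 / ((1 + 25 / 8) * (600 * (27 / 4 : ℝ) ^ 6 + a))) ^ 2 := by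
    have h := mul_le_mul hP2 he9 (Real.exp_pos _).le (le_trans (inv_pos.2 hP2pos).le hP2)
    have e : (6 : ℝ) / mB ^ 2 * 3 = 18 / (2 / ((1 + 25 / 8) * (600 * (27 / 4 : ℝ) ^ 6 + a))) ^ 2 := by rw [hmBc]; ring
    rw [e] at h
    exact h
  set C : ℝ := (8 * M * Real.sqrt (sx) * Real.exp (3 * μ)) ^ 2
          * (((2 / ((1 + sx) * (dEx + a))) ^ 2 / 2 - 3 * ((Real.sqrt M * (2 + Real.sqrt M)
          * (Real.sqrt 3 * (η)⁻¹ * (Real.exp (μ' * η) - 1) + (Real.sqrt 3 * (η)⁻¹ * (Real.exp (μ' * η) - 1)) ^ 2 + Real.sqrt a * (Real.sqrt (sx)) * (Real.exp (3 * μ') - 1) + a * (Real.sqrt (sx)) ^ 2 * (Real.exp (3 * μ') - 1) ^ 2)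
          * (8 * Real.sqrt M + 8 * Real.sqrt M ^ 2)
          * ((Real.sqrt (sx)) * (1 + (Real.exp (3 * μ') - 1))) + M * ((Real.sqrt (sx)) * (Real.exp (3 * μ') - 1)))) ^ 2)⁻¹ * Real.exp (9 * μ'))
          * (4 * (2 * (1 + 1 / (μ - μ'))) ^ 3) ^ 2 with hCdef
  have hC0 : 0 ≤ C := by
    rw [hCdef]
    exact mul_nonneg (mul_nonneg (sq_nonneg _) (mul_nonneg (inv_pos.2 hP2pos).le (Real.exp_pos _).le)) (sq_nonneg _)
  set Cm : ℝ := ((24 * (max 2 (16 / a)) * Real.sqrt (25 / 8)) ^ 2 * (18 / (2 / ((1 + 25 / 8) * (600 * (27 / 4 : ℝ) ^ 6 + a))) ^ 2) * (4 * (2 * (1 + 2 / μ)) ^ 3) ^ 2) with hCmdef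
  have hCm0 : 0 ≤ Cm := by rw [hCmdef]; positivity
  have hCle : C ≤ Cm := by
    rw [hCdef, hCmdef]
    exact mul_le_mul (mul_le_mul hP1 hP2' (by positivity) (by positivity)) hP3 (by positivity) (by positivity)
  clear_value G C Cm
  -- the S-letters
  have hS0 : C * (2 * (1 + 1 / μ')) ^ 3 ≤ Cm * (2 * (1 + ν)) ^ 3 := by
    apply mul_le_mul hCle _ (by positivity) hCm0
    gcongr
  have hS1 : C * ((2 / μ') * (2 * (1 + 1 / (μ' / 2))) ^ 3) ≤ Cm * (2 * ν * (2 * (1 + 2 * ν)) ^ 3) := by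
    apply mul_le_mul hCle _ (by positivity) hCm0
    apply mul_le_mul h2ν _ (by positivity) (by positivity)
    gcongr
  have hS0sq : (C * (2 * (1 + 1 / μ')) ^ 3) ^ 2 ≤ (Cm * (2 * (1 + ν)) ^ 3) ^ 2 := pow_le_pow_left₀ (by positivity) hS0 2
  have hS1sq : (C * ((2 / μ') * (2 * (1 + 1 / (μ' / 2))) ^ 3)) ^ 2 ≤ (Cm * (2 * ν * (2 * (1 + 2 * ν)) ^ 3)) ^ 2 :=
    pow_le_pow_left₀ (by positivity) hS1 2
  -- assemble
  rw [hf1]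
  calc 2 * 2880 / Ls ^ 2 * (C * ((2 / μ') * (2 * (1 + 1 / (μ' / 2))) ^ 3)) ^ 2
        + 8 * (((3:ℝ) * (ℓ - 1)) ^ 2 * (2880 / (Ls * ℓ) ^ 2)) * (C * (2 * (1 + 1 / μ')) ^ 3) ^ 2
      ≤ 2 * 2880 / Ls ^ 2 * (Cm * (2 * ν * (2 * (1 + 2 * ν)) ^ 3)) ^ 2 + 72 * 2880 / Ls ^ 2 * (Cm * (2 * (1 + ν)) ^ 3) ^ 2 := by
        apply add_le_add
        · exact mul_le_mul_of_nonneg_left hS1sq (by positivity)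
        · exact mul_le_mul hf2 hS0sq (by positivity) (by positivity)
    _ = _ := by field_simp


end Summit.QuantumFields.YangMills.Theorems.Prop7LODSlotK2WindowLetters

end
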